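import Mathlib.NumberTheory.LSeries.DirichletContinuation
import Mathlib.NumberTheory.DirichletCharacter.Orthogonality
import Mathlib.NumberTheory.LegendreSymbol.QuadraticChar.Basic
import Mathlib.Analysis.SpecialFunctions.Log.Basic
import Literature.NumberTheory.LFunctions.MollifierOptimality
import HarnessLib

/-!
# Central non-vanishing records for Dirichlet `L`-functions by mollified moments
# (Khan–Ngo 2016, Khan–Milićević–Ngo 2021/22, Qin–Wu 2025, Baluyot–Pratt 2021/22)

Topic `Literature/NumberTheory/LFunctions` (namespace `Literature.NumberTheory.LFunctions`).
STATEMENT LAYER (D-0014: sorry-free named `Prop` facts, nothing asserted), typed for the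
LANDAU–SIEGEL PROGRAMME (cell `landau-siegel`, §C literature harvest topic r4 "mollifier
technology"; rows R4-03, R4-05 and the record table of HOME/lit/r4/ROWS.md). These are the printed
RECORD PROPORTIONS for `L(1/2, χ) ≠ 0` obtained by the mollifier method — the numbers against which
the programme measures the "`1/2`-proportion" edge (any proportion `> 1/2` WITH a value lower bound
has Landau–Siegel consequences by Iwaniec–Sarnak; every unconditional record below is `< 1/2`).
The programme SEARCHES and TYPES; no claim about Landau–Siegel zeros is made here.

## What the sources print (read 2026-08-26 on the arXiv TeX sources)

* **Khan–Ngo 2016, Theorem 1.1** (ANT 10 (2016) 2081–2091 = arXiv:1512.04030): "Let `ε > 0` be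
  arbitrary. For all primes `p` large enough in terms of `ε`, there are at least `(3/8 − ε)` of the
  primitive Dirichlet characters `χ` (mod `p`) for which `L(1/2, χ) ≠ 0`." (Michel–VanderKam
  two-piece mollifier of length `p^θ`, any `θ < 3/10`, proportion `2θ/(1+2θ)`.) Followed by: "An
  interesting open problem that remains is to increase the length of the Iwaniec-Sarnak mollifier."
* **Khan–Milićević–Ngo, Theorem 1.1** (Math. Z. 300 (2022) 1603–1613 = arXiv:1911.10268): "Let
  `ε > 0` be arbitrary. For all primes `p` large enough in terms of `ε`, for at least `(5/13 − ε)`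
  of all primitive Dirichlet characters `χ` of modulus `p`, we have that `L(1/2, χ) ≠ 0`."
  (Unbalanced two-piece mollifier, pieces of length `p^{3/8−ε}` and `p^{1/4−ε}`;
  `(1 + 1/(5/8))⁻¹ = 5/13`.)
* **Qin–Wu 2025, Theorem 1** (arXiv:2504.11916): "For sufficiently large integers `q`, there are at
  least `7/19 − ε` of primitive Dirichlet characters `χ` (mod `q`) for which `L(s, χ) ≠ 0`"
  [at `s = 1/2`; GENERAL modulus; vacuous for `q ≡ 2 (mod 4)` where no primitive character exists].
* **Baluyot–Pratt, Theorem 1.1** (JEMS 24 (2022) 369–460 = arXiv:1809.09992): "There exists an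
  absolute, effective constant `X₀` such that if `X ≥ X₀` then
  `#{p ≤ X : p ≡ 1 (mod 8), L(1/2, χ_p) ≠ 0} ≥ .0964 · #{p ≤ X : p ≡ 1 (mod 8)}`", `χ_p` the real
  primitive character of conductor `p`. **Theorem 1.2**: with
  `𝔠 := (144 ζ(2) (1 − 1/√2)²)⁻¹ = .0492…`, for large `X`,
  `(𝔠 − o(1)) (X/4)(log X)³ ≤ Σ_{p ≤ X, p ≡ 1 (8)} (log p) L(1/2, χ_p)² ≤ (4𝔠 + o(1)) (X/4)(log X)³`.

## Rendering choices

* "at least `c − ε` of the primitive characters" = `(c − ε) · #{primitive χ mod q} ≤ #{primitive χ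
  mod q : L(1/2, χ) ≠ 0}` (no division). `L(1/2, χ)` = Mathlib's `DirichletCharacter.LFunction χ (1/2)`;
  primitivity = `DirichletCharacter.IsPrimitive`.
* `χ_p` for a prime `p ≡ 1 (mod 8)`: the Kronecker symbol `(p/·)`; as a Dirichlet character mod `p`
  it is the Legendre symbol `(·/p)` (quadratic reciprocity, `p ≡ 1 (mod 4)`), i.e. Mathlib's
  `quadraticChar (ZMod p)` pushed to `ℂ` — the tree's rendering in
  `PrimitiveQuadraticCharacter.eq_quadraticChar_of_isQuadratic`.
* `L(1/2, χ_p)²` for the real character `χ_p` is typed as `‖L(1/2, χ_p)‖²` (the same real number,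
  `L(1/2, χ_p)` being real); `p ≤ X` with real `X` = `p ≤ ⌊X⌋`; `o(1)` = "`± ε` for every `ε > 0`
  and all large `X`". "Effective `X₀`" is recorded in prose only (`∃ X₀`).

* **Khan–Milićević–Ngo, §2–§3, §5** (appended 2026-08-26): the unbalanced mollifier (2.3)
  `M(χ) = c₁ Σ_{m≤MR} y_m χ(m) m^{−1/2} + c₂ (τ̄_χ/√p) Σ_{m≤M} y_m χ̄(m) m^{−1/2}` (`M = p^θ`,
  `R = p^α`), the moments `𝒮₁ = (2/p) Σ⁺ L(½,χ)M(χ)`, `𝒮₂ = (2/p) Σ⁺ |L(½,χ)M(χ)|²` over even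
  primitive `χ` ((2.4)–(2.5)), and the printed evaluations (3.3) "`𝒮₁ = c₁ + c₂ + O(p^{−ε})`" and
  (3.8) "`𝒮₂ = c₁²/(θ+α) + c₂²/θ + (c₁+c₂)² + O(p^{−ε})`, assuming (5.2)–(5.4)" — typed as the
  named facts `khanMilicevicNgo2021_firstMoment` / `_secondMoment` (power saving recorded as some
  `δ > 0`), each piece being the tree's `CechMatomaki2025.mollifierIS` of its own length; PROVED:
  `KMN2021.proportion_optimalWeights` (§5: `c₁ : c₂ = (θ+α) : θ` gives `(1 + 1/(2θ+α))⁻¹`),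
  `KMN2021.Constraint.length_lt` (`2θ + α < 5/8`), `KMN2021.proportion_at_record`.

* **Qin–Wu 2025, §2** (appended 2026-08-26): mollifier (2.1) (general `q`, lengths `q^{θ₁}`,
  `q^{θ₂}`), moments (2.2)–(2.3) (`2/φ*(q)`, even primitive `χ`), "Proposition 3. For
  `q ≢ 2 (mod 4)` and `θ₁, θ₂ ∈ (0, ½−ε)`, we have `𝓜₁ = c₁+c₂+O(q^{−ε})`"; "Proposition 4. For
  `q ≢ 2 (mod 4)`, let `q̊ = q^γ` with `0 ≤ γ ≤ 1/3`. We have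
  `𝓜₂ = c₁²/θ₁ + c₂²/θ₂ + (c₁+c₂)² + O(log log q/log q)` when `θ₁, θ₂ ∈ (0, ½−ε)` satisfy
  `4θ₁+6θ₂ < 3+γ`, `2θ₁+θ₂ < 1−γ`, `4θ₁ < 1−γ`" (`q̊ = ∏_{p^{2k+1} ∥ q, k≥1} p`, (1.6)) — named facts
  `qinWu2025_proposition3/4`; PROVED `QinWu2025.proportion_optimalWeights`, `range_at_record`,
  `value_at_record` (`(7+γ)/(19+γ)`), `seven_nineteenths_le`, `Range.length_lt` (`θ₁+θ₂ < 7/12 + γ/12`),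
  and `KMN2021.mollifier_eq` / `secondMainTerm_eq` (KMN = Qin–Wu at `(θ+α, θ)`). STATUS of the
  Qin–Wu facts (`qinWu2025_theorem1`, `_proposition3`, `_proposition4`): preprint claims, unrefereed
  (arXiv:2504.11916, zbMATH «Preprint» at 2026-08), tagged `[claim: QinWu2025, status: under-review]`
  per fact (cell landau-siegel REF-C request 2026-08-26T22:14:30Z); the PROVED `QinWu2025.*` lemmas are
  elementary and carry no claim.

WHAT THIS IS NOT: not the (withdrawn) `q`-averaged `50.073 %` of Pratt 2019 (arXiv:1804.01445v2,
author's note of an error; see `MollifierOptimality.lean`); not a claim beyond the printed numbers.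

## References
* [KhanNgo2016] Theorem 1.1 and the sentence after it. * [KhanMilicevicNgo2021] Theorem 1.1, §2 (2.3)–(2.5), §3 (3.3), (3.8), Lemma 3.1, §5 (5.2)–(5.4).
* [QinWu2025] Theorem 1, §1 (1.2)–(1.3), (1.6), §2 (2.1)–(2.3), Propositions 3–4, (2.6), proof of Theorem 1. * [BaluyotPratt2021] Theorems 1.1, 1.2.
-/

noncomputable section

open Finset

namespace Literature.NumberTheory.LFunctions

namespace DirichletNonvanishing

open scoped Classical in
/-- `φ*(q)`: the number of primitive Dirichlet characters mod `q`.
[cite: KhanMilicevicNgo2021, Theorem 1.1] -/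
def primitiveCount (q : ℕ) : ℕ :=
  (univ.filter fun χ : DirichletCharacter ℂ q => χ.IsPrimitive).card

open scoped Classical in
/-- The number of primitive `χ` mod `q` with `L(1/2, χ) ≠ 0`.
[cite: KhanMilicevicNgo2021, Theorem 1.1] -/
def nonvanishingCount (q : ℕ) [NeZero q] : ℕ :=
  (univ.filter fun χ : DirichletCharacter ℂ q => χ.IsPrimitive ∧ χ.LFunction (1 / 2) ≠ 0).card

/-- "For all primes `p` large enough in terms of `ε`, at least `(c − ε)` of the primitive characters
mod `p` have `L(1/2, χ) ≠ 0`" — the shape of the prime-modulus records.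
[cite: KhanNgo2016, Theorem 1.1] -/
def PrimeModulusProportion (c : ℝ) : Prop :=
  ∀ ε : ℝ, 0 < ε → ∃ p₀ : ℕ, ∀ (p : ℕ) [NeZero p], p.Prime → p₀ ≤ p →
    (c - ε) * (primitiveCount p : ℝ) ≤ (nonvanishingCount p : ℝ)

/-- The same shape for ALL large moduli `q` (general modulus records).
[cite: QinWu2025, Theorem 1] -/
def GeneralModulusProportion (c : ℝ) : Prop :=
  ∀ ε : ℝ, 0 < ε → ∃ q₀ : ℕ, ∀ (q : ℕ) [NeZero q], q₀ ≤ q →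
    (c - ε) * (primitiveCount q : ℝ) ≤ (nonvanishingCount q : ℝ)

/-- A general-modulus proportion is in particular a prime-modulus proportion.
[cite: QinWu2025, §1.3 (comparison with the prime-modulus record)] -/
theorem GeneralModulusProportion.prime {c : ℝ} (h : GeneralModulusProportion c) :
    PrimeModulusProportion c := by
  intro ε hε
  obtain ⟨q₀, hq₀⟩ := h ε hε
  exact ⟨q₀, fun p _ _ hp => hq₀ p hp⟩

/-- Monotonicity in the constant: a record `c` implies every smaller `c'` (how KMN's `5/13`
"improv[es] on the previous best known" `3/8`). [cite: KhanMilicevicNgo2021, §1] -/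
theorem PrimeModulusProportion.mono {c c' : ℝ} (h : PrimeModulusProportion c) (hc : c' ≤ c) :
    PrimeModulusProportion c' := by
  intro ε hε
  obtain ⟨p₀, hp₀⟩ := h ε hε
  refine ⟨p₀, fun p _ hp hle => (le_trans ?_ (hp₀ p hp hle))⟩
  exact mul_le_mul_of_nonneg_right (by linarith) (Nat.cast_nonneg _)

/-! ### The quadratic character of prime conductor -/

/-- `χ_p` (`p` an odd prime): the real primitive character mod `p`, i.e. the Legendre symbol
`(·/p)` as a complex Dirichlet character (for `p ≡ 1 (mod 4)` this is the Kronecker symbol `(p/·)`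
of Baluyot–Pratt). [cite: BaluyotPratt2021, §2 (notation)] -/
def legendreChar (p : ℕ) [Fact p.Prime] : DirichletCharacter ℂ p :=
  (quadraticChar (ZMod p)).ringHomComp (Int.castRingHom ℂ)

open scoped Classical in
/-- `#{p ≤ X : p prime, p ≡ 1 (mod 8)}`. [cite: BaluyotPratt2021, Theorem 1.1] -/
def primesOneModEightCount (X : ℝ) : ℕ :=
  ((range (⌊X⌋₊ + 1)).filter fun p : ℕ => p.Prime ∧ p % 8 = 1).card

open scoped Classical in
/-- `#{p ≤ X : p prime, p ≡ 1 (mod 8), L(1/2, χ_p) ≠ 0}`. [cite: BaluyotPratt2021, Theorem 1.1] -/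
def primesOneModEightNonvanishingCount (X : ℝ) : ℕ :=
  ((range (⌊X⌋₊ + 1)).filter fun p : ℕ =>
      ∃ hp : p.Prime, p % 8 = 1 ∧
        (haveI : Fact p.Prime := ⟨hp⟩; (legendreChar p).LFunction (1 / 2) ≠ 0)).card

open scoped Classical in
/-- The weighted second moment `Σ_{p ≤ X, p ≡ 1 (mod 8)} (log p) L(1/2, χ_p)²`
(`L(1/2, χ_p)² = |L(1/2, χ_p)|²`, the value being real). [cite: BaluyotPratt2021, Theorem 1.2] -/
def secondMomentPrimeConductor (X : ℝ) : ℝ :=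
  ∑ p ∈ (range (⌊X⌋₊ + 1)).filter (fun p : ℕ => p.Prime ∧ p % 8 = 1),
    if hp : p.Prime then
      Real.log p * (haveI : Fact p.Prime := ⟨hp⟩; ‖(legendreChar p).LFunction (1 / 2)‖ ^ 2)
    else 0

/-- Baluyot–Pratt's constant `𝔠 := (144 ζ(2) (1 − 1/√2)²)⁻¹ = .0492…` (`ζ(2) = π²/6`).
[cite: BaluyotPratt2021, Theorem 1.2] -/
def bpConstant : ℝ := (144 * (Real.pi ^ 2 / 6) * (1 - 1 / Real.sqrt 2) ^ 2)⁻¹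

end DirichletNonvanishing

open DirichletNonvanishing

/-! ### The named facts -/

/-- **Khan–Ngo 2016, Theorem 1.1**: for all primes `p` large in terms of `ε`, at least `3/8 − ε`
of the primitive characters mod `p` have `L(1/2, χ) ≠ 0`. NAMED FACT, not proved here.
[cite: KhanNgo2016, Theorem 1.1] -/
def khanNgo2016_theorem11 : Prop := PrimeModulusProportion (3 / 8)

/-- **Khan–Milićević–Ngo 2021/22, Theorem 1.1**: for all primes `p` large in terms of `ε`, at least
`5/13 − ε` of the primitive characters mod `p` have `L(1/2, χ) ≠ 0` (the prime-modulus record as of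
2026-08). NAMED FACT, not proved here. [cite: KhanMilicevicNgo2021, Theorem 1.1] -/
def khanMilicevicNgo2021_theorem11 : Prop := PrimeModulusProportion (5 / 13)

/-- **Qin–Wu 2025, Theorem 1**: for all sufficiently large integers `q`, at least `7/19 − ε` of the
primitive characters mod `q` have `L(1/2, χ) ≠ 0` (the general-modulus record as of 2026-08;
`7/19 < 5/13`). NAMED FACT, not proved here. Status: preprint claim, unrefereed (arXiv:2504.11916; zbMATH
«Preprint») [claim: QinWu2025, status: under-review]. [cite: QinWu2025, Theorem 1] -/
def qinWu2025_theorem1 : Prop := GeneralModulusProportion (7 / 19)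

/-- **Baluyot–Pratt 2021/22, Theorem 1.1**: there is an (effective, absolute) `X₀` such that for
`X ≥ X₀`, `#{p ≤ X : p ≡ 1 (8), L(1/2, χ_p) ≠ 0} ≥ .0964 · #{p ≤ X : p ≡ 1 (8)}` — more than nine
percent of the central values of prime conductor are non-zero. NAMED FACT, not proved here.
[cite: BaluyotPratt2021, Theorem 1.1] -/
def baluyotPratt2021_theorem11 : Prop :=
  ∃ X₀ : ℝ, ∀ X : ℝ, X₀ ≤ X →
    (0.0964 : ℝ) * (primesOneModEightCount X : ℝ) ≤ (primesOneModEightNonvanishingCount X : ℝ)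

/-- **Baluyot–Pratt 2021/22, Theorem 1.2** (order of magnitude of the second moment over prime
conductors): for every `ε > 0` and all large `X`,
`(𝔠 − ε)(X/4)(log X)³ ≤ Σ_{p ≤ X, p ≡ 1 (8)} (log p) L(1/2, χ_p)² ≤ (4𝔠 + ε)(X/4)(log X)³`.
NAMED FACT, not proved here. [cite: BaluyotPratt2021, Theorem 1.2] -/
def baluyotPratt2021_theorem12 : Prop :=
  ∀ ε : ℝ, 0 < ε → ∃ X₀ : ℝ, ∀ X : ℝ, X₀ ≤ X →
    (bpConstant - ε) * (X / 4) * Real.log X ^ 3 ≤ secondMomentPrimeConductor X ∧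
      secondMomentPrimeConductor X ≤ (4 * bpConstant + ε) * (X / 4) * Real.log X ^ 3

/-! ### Bookkeeping (proved): the record table is increasing and below `1/2` -/

/-- `1/3 < 3/8 < 5/13 < 1/2` and `0.3411 < 7/19 < 5/13`: the prime-modulus records (Iwaniec–Sarnak
`1/3`, Khan–Ngo `3/8`, KMN `5/13`) and the general-modulus records (Bui `0.3411`, Qin–Wu `7/19`)
increase and stay below the `1/2` edge. [cite: QinWu2025, §1.3] -/
theorem records_increasing :
    (1 : ℝ) / 3 < 3 / 8 ∧ (3 : ℝ) / 8 < 5 / 13 ∧ (5 : ℝ) / 13 < 1 / 2 ∧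
      (0.3411 : ℝ) < 7 / 19 ∧ (7 : ℝ) / 19 < 5 / 13 := by
  norm_num

/-- `(1 + 1/(5/8))⁻¹ = 5/13`: the KMN proportion from combined mollifier length `5/8`
(`θ₁ + θ₂ = 3/8 + 1/4`). [cite: KhanMilicevicNgo2021, §3.3 (proof of Theorem 1.1)] -/
theorem kmn_value : (1 + 1 / ((3 : ℝ) / 8 + 1 / 4))⁻¹ = 5 / 13 := by norm_num

/-- `(1 + 1/(θ₁+θ₂))⁻¹ = 7/19` at Qin–Wu's lengths `θ₁ = 1/4`, `θ₂ = 1/3` (the case `γ = 0`).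
[cite: QinWu2025, §2 (proof of Theorem 1)] -/
theorem qinWu_value : (1 + 1 / ((1 : ℝ) / 4 + 1 / 3))⁻¹ = 7 / 19 := by norm_num

/-- KMN's record implies Khan–Ngo's (monotonicity of the record shape).
[cite: KhanMilicevicNgo2021, §1] -/
theorem khanNgo2016_of_kmn (h : khanMilicevicNgo2021_theorem11) : khanNgo2016_theorem11 :=
  PrimeModulusProportion.mono h (by norm_num)

/-! ### Smooth square-free conductors (Leung 2024/25) — appended 2026-08-26

S.-K. Leung, *Non-vanishing of Dirichlet `L`-functions with smooth conductors*, Ramanujan J. 66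
(2025), Paper No. 69 = arXiv:2410.01713 [bib: `Leung2024`], **Theorem 1.1** (read on the arXiv TeX
source): "There exist real numbers `Q, η > 0` such that for any square-free integer `q > Q` which is
`q^η`-smooth, i.e. without prime factors exceeding `q^η`, we have `L(1/2, χ) ≠ 0` for at least
`35.9%` of the primitive characters modulo `q`." (Michel–VanderKam two-piece mollifier; the cross
term treated by the `q`-van der Corput method.) Conditionally (the short-sum conjecture of its §5)
the method reaches `2/5`; both are `< 1/2`. -/

/-- "`q` is `y`-smooth": every prime factor of `q` is `≤ y`. [cite: Leung2024, Theorem 1.1] -/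
def DirichletNonvanishing.IsSmooth (q : ℕ) (y : ℝ) : Prop :=
  ∀ p : ℕ, p.Prime → p ∣ q → (p : ℝ) ≤ y

/-- **Leung 2024/25, Theorem 1.1**: there are `Q, η > 0` such that for every square-free,
`q^η`-smooth `q > Q`, at least `35.9 %` of the primitive characters mod `q` have `L(1/2, χ) ≠ 0`.
NAMED FACT, not proved here. [cite: Leung2024, Theorem 1.1] -/
def leung2024_theorem11 : Prop :=
  ∃ Q η : ℝ, 0 < Q ∧ 0 < η ∧ ∀ (q : ℕ) [NeZero q], Q < q → Squarefree q →
    DirichletNonvanishing.IsSmooth q ((q : ℝ) ^ η) →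
      (0.359 : ℝ) * (primitiveCount q : ℝ) ≤ (nonvanishingCount q : ℝ)

/-- Leung's `35.9 %` exceeds Bui's general-modulus `0.3411` but is below the later general-modulus
record `7/19` of Qin–Wu (2025); its conditional `2/5` exceeds the prime-modulus record `5/13` and is
still `< 1/2`. [cite: Leung2024, §1 and §5] -/
theorem leung_value_between :
    (0.3411 : ℝ) < 0.359 ∧ (0.359 : ℝ) < 7 / 19 ∧ (5 : ℝ) / 13 < 2 / 5 ∧ (2 : ℝ) / 5 < 1 / 2 := by
  norm_num


/-! ### Khan–Milićević–Ngo 2022, §2–§3, §5: the mollified moments behind the record `5/13`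

The unbalanced two-piece mollifier (2.3) and the two MEAN-VALUE theorems (3.3), (3.8) that feed the
Cauchy–Schwarz inequality — the "`E(d)`-shaped" inputs of the design, typed as printed (prime modulus
`p`, even primitive characters, normalisation `2/p`), together with the optimisation of §5 (PROVED:
with weights `c₁ : c₂ = (θ+α) : θ` the main terms give `(1 + 1/(2θ+α))⁻¹`, and the constraints
(5.2)–(5.4) force `2θ + α < 5/8`). The coefficients of each piece are the Iwaniec–Sarnak/Michel–VanderKam
weights `y_m = μ(m) log(Y/m)/log Y` with `Y` THE LENGTH OF THAT PIECE (§3.2: the piece of length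
`p^{θ+α}` has IS main term `1/(θ+α) + 1`), i.e. each piece is the tree's
`CechMatomaki2025.mollifierIS p (length exponent)`. -/

namespace KMN2021

open CechMatomaki2025 ComplexConjugate

/-- The Khan–Milićević–Ngo mollifier (2.3):
`M(χ) = c₁ Σ_{m ≤ MR} y_m χ(m) m^{−1/2} + c₂ (τ̄_χ/√p) Σ_{m ≤ M} y_m χ̄(m) m^{−1/2}`, `M = p^θ`,
`R = p^α`, `y_m = μ(m) log(Y/m)/log Y` for a piece of length `Y`; here `τ̄_χ/√p = conj(ε_χ)` and the
second sum is the complex conjugate of the IS mollifier of length `p^θ` (its coefficients are real).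
[cite: KhanMilicevicNgo2021, §2 (2.3)] -/
def mollifier (p : ℕ) (θ α c₁ c₂ : ℝ) (χ : DirichletCharacter ℂ p) : ℂ :=
  (c₁ : ℂ) * mollifierIS (p : ℝ) (θ + α) χ +
    (c₂ : ℂ) * conj (rootNumber χ) * conj (mollifierIS (p : ℝ) θ χ)

open scoped Classical in
/-- The mollified first moment (2.4): `𝒮₁ = (2/p) Σ⁺_{χ mod p} L(½,χ) M(χ)`, the sum over the EVEN
primitive characters mod `p`. [cite: KhanMilicevicNgo2021, §2 (2.4)] -/
def firstMoment (p : ℕ) (θ α c₁ c₂ : ℝ) : ℂ :=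
  (2 / p : ℂ) * ∑ χ : DirichletCharacter ℂ p,
    if χ.IsPrimitive ∧ χ.Even then centralValue p χ * mollifier p θ α c₁ c₂ χ else 0

open scoped Classical in
/-- The mollified second moment (2.5): `𝒮₂ = (2/p) Σ⁺_{χ mod p} |L(½,χ) M(χ)|²` (even primitive `χ`).
[cite: KhanMilicevicNgo2021, §2 (2.5)] -/
def secondMoment (p : ℕ) (θ α c₁ c₂ : ℝ) : ℝ :=
  2 / p * ∑ χ : DirichletCharacter ℂ p,
    if χ.IsPrimitive ∧ χ.Even then ‖centralValue p χ * mollifier p θ α c₁ c₂ χ‖ ^ 2 else 0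

/-- The optimisation constraints (5.2)–(5.4) ("the conditions of Corollary 4.2"):
`0 < θ < ½ − ε`, `0 < θ + α < ½ − ε`, `3θ + 2α − 1 < 0`, `10θ + 4α − 3 < 0`.
[cite: KhanMilicevicNgo2021, §5 (5.2)–(5.4)] -/
def Constraint (ε θ α : ℝ) : Prop :=
  0 < θ ∧ θ < 1 / 2 - ε ∧ 0 < θ + α ∧ θ + α < 1 / 2 - ε ∧ 3 * θ + 2 * α - 1 < 0 ∧
    10 * θ + 4 * α - 3 < 0

/-- The main term of `𝒮₂` ((3.8), second line): `c₁²/(θ+α) + c₂²/θ + (c₁+c₂)²`.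
[cite: KhanMilicevicNgo2021, §3.2 (3.8)] -/
def secondMainTerm (θ α c₁ c₂ : ℝ) : ℝ := c₁ ^ 2 / (θ + α) + c₂ ^ 2 / θ + (c₁ + c₂) ^ 2

/-- Lemma 3.1's proportion `|𝒮₁|²/𝒮₂` from the main terms:
`((c₁/(c₁+c₂))²/(θ+α) + (c₂/(c₁+c₂))²/θ + 1)⁻¹ = (c₁+c₂)²/secondMainTerm`.
[cite: KhanMilicevicNgo2021, Lemma 3.1 (3.9)] -/
def proportion (θ α c₁ c₂ : ℝ) : ℝ := (c₁ + c₂) ^ 2 / secondMainTerm θ α c₁ c₂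

/-- Under (5.3)–(5.4) the combined length exponent satisfies `2θ + α < 5/8`
(§5: `2θ+α = ¼(3θ+2α) + ⅛(10θ+4α) < 5/8`). [cite: KhanMilicevicNgo2021, §5] -/
theorem Constraint.length_lt {ε θ α : ℝ} (h : Constraint ε θ α) : 2 * θ + α < 5 / 8 := by
  obtain ⟨-, -, -, -, h₁, h₂⟩ := h
  linarith

/-- §5: with the optimal weights `c₁ : c₂ = (θ+α) : θ` the main terms give the proportion
`(1 + 1/(2θ+α))⁻¹` ("`p^{2θ+α} = MR·M` is the combined length of the mollifier").
[cite: KhanMilicevicNgo2021, §5] -/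
theorem proportion_optimalWeights {θ α : ℝ} (hθ : 0 < θ) (hθα : 0 < θ + α) :
    proportion θ α (θ + α) θ = (1 + 1 / (2 * θ + α))⁻¹ := by
  have h1 : θ + α ≠ 0 := hθα.ne'
  have h2 : θ ≠ 0 := hθ.ne'
  have h3 : 2 * θ + α ≠ 0 := by linarith
  have h4 : 1 + 2 * θ + α ≠ 0 := by linarith
  unfold proportion secondMainTerm
  rw [show (θ + α) ^ 2 / (θ + α) = θ + α from by rw [sq, mul_div_assoc, div_self h1, mul_one],
    show θ ^ 2 / θ = θ from by rw [sq, mul_div_assoc, div_self h2, mul_one]]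
  rw [show θ + α + θ + (θ + α + θ) ^ 2 = (2 * θ + α) * (1 + 2 * θ + α) from by ring,
    show (θ + α + θ) ^ 2 = (2 * θ + α) * (2 * θ + α) from by ring,
    mul_div_mul_left _ _ h3, one_add_div h3, inv_div,
    div_eq_div_iff h4 (by linarith : 2 * θ + α + 1 ≠ 0)]
  ring

/-- With the essentially optimal exponents `θ = ¼ − ε`, `α = ⅛ − ε` (§5) and `c₁ : c₂ = (θ+α) : θ`,
the proportion is `(1 + 1/(5/8 − 3ε))⁻¹`, which is `< 5/13` and tends to `5/13`.
[cite: KhanMilicevicNgo2021, §5] -/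
theorem proportion_at_record {ε : ℝ} (hε : 0 < ε) (hε' : ε < 1 / 8) :
    proportion (1 / 4 - ε) (1 / 8 - ε) (1 / 4 - ε + (1 / 8 - ε)) (1 / 4 - ε)
      = (1 + 1 / (5 / 8 - 3 * ε))⁻¹ := by
  rw [proportion_optimalWeights (by linarith) (by linarith)]
  congr 2; ring

end KMN2021

/-- **Khan–Milićević–Ngo 2022, (3.3)** (mollified first moment). For the mollifier (2.3) with
`c₁, c₂ > 0` and exponents subject to (5.2)–(5.4): `𝒮₁ = c₁ + c₂ + O(p^{−ε})` as `p → ∞` through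
the primes (main term from `n = m = 1`; the error is a power saving as long as both pieces have
length `< p^{½−ε}`, imported from Michel–VanderKam). RENDERING: the paper writes the saving as
`O(p^{−ε})` with the `ε` of (5.2); we record a power saving `δ > 0` depending on the parameters
(weaker, implied). [cite: KhanMilicevicNgo2021, §3.1 (3.3)] -/
def khanMilicevicNgo2021_firstMoment : Prop :=
  ∀ ε θ α c₁ c₂ : ℝ, 0 < ε → 0 < α → KMN2021.Constraint ε θ α → 0 < c₁ → 0 < c₂ →
    ∃ δ : ℝ, 0 < δ ∧ ∃ C : ℝ, ∀ p : ℕ, p.Prime →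
      ‖KMN2021.firstMoment p θ α c₁ c₂ - (c₁ + c₂ : ℝ)‖ ≤ C * (p : ℝ) ^ (-δ)

/-- **Khan–Milićević–Ngo 2022, (3.8)** (mollified second moment — the new mean-value theorem of the
paper, resting on the bilinear Kloosterman estimates of §4 / Corollary 4.2). For the mollifier (2.3)
with `c₁, c₂ > 0` and `(θ, α)` subject to (5.2)–(5.4):
`𝒮₂ = c₁²(1/(θ+α) + 1) + c₂²(1/θ + 1) + 2c₁c₂ + O(p^{−ε}) = c₁²/(θ+α) + c₂²/θ + (c₁+c₂)² + O(p^{−ε})`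
(`p` prime, `p → ∞`). RENDERING as for (3.3): a power saving `δ > 0` depending on the parameters.
Consequence (Lemma 3.1 + §5, with `proportion_optimalWeights` and `Constraint.length_lt`): the
non-vanishing proportion `(1 + 1/(2θ+α))⁻¹ − ε < 5/13` of `khanMilicevicNgo2021_theorem11`.
[cite: KhanMilicevicNgo2021, §3.2 (3.8)] -/
def khanMilicevicNgo2021_secondMoment : Prop :=
  ∀ ε θ α c₁ c₂ : ℝ, 0 < ε → 0 < α → KMN2021.Constraint ε θ α → 0 < c₁ → 0 < c₂ →
    ∃ δ : ℝ, 0 < δ ∧ ∃ C : ℝ, ∀ p : ℕ, p.Prime →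
      |KMN2021.secondMoment p θ α c₁ c₂ - KMN2021.secondMainTerm θ α c₁ c₂| ≤ C * (p : ℝ) ^ (-δ)



/-! ### Qin–Wu 2025, §2: the mollified moments behind the general-modulus record `7/19`

Same technology for a GENERAL modulus `q ≢ 2 (mod 4)`: the two-piece mollifier (2.1) with pieces of
lengths `q^{θ₁}`, `q^{θ₂}` (IS weights of their own lengths), moments (2.2)–(2.3) over the even
primitive characters normalised by `2/φ*(q)`, Proposition 3 (first moment, `O(q^{−ε})`) and
Proposition 4 (second moment, `O(log log q/log q)`, in the range (2.6) governed by
`q̊ = ∏_{p^{2k+1} ∥ q, k ≥ 1} p = q^γ`). PROVED: the optimisation (`c₁ : c₂ = θ₁ : θ₂` gives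
`(1 + 1/(θ₁+θ₂))⁻¹`) and the exponent bookkeeping of the proof of Theorem 1
(`θ₁ + θ₂ < 7/12 + γ/12`, value `(7+γ)/(19+γ)` at the printed choice for `γ ≤ 1/5`). -/

namespace QinWu2025

open CechMatomaki2025 ComplexConjugate

/-- The Qin–Wu mollifier (2.1) (= (1.3), the Michel–VanderKam/KMN shape for a general modulus):
`M(χ) = c₁ Σ_{m ≤ M} a(m) χ(m) m^{−1/2} + c₂ (τ̄_χ/√q) Σ_{m ≤ R} a(m) χ̄(m) m^{−1/2}`, `M = q^{θ₁}`,
`R = q^{θ₂}`, `a(m) = μ(m) log(y/m)/log y` ((1.2), `y` the length of the piece).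
[cite: QinWu2025, §2 (2.1)] -/
def mollifier (q : ℕ) (θ₁ θ₂ c₁ c₂ : ℝ) (χ : DirichletCharacter ℂ q) : ℂ :=
  (c₁ : ℂ) * mollifierIS (q : ℝ) θ₁ χ + (c₂ : ℂ) * conj (rootNumber χ) * conj (mollifierIS (q : ℝ) θ₂ χ)

/-- The KMN mollifier is the Qin–Wu mollifier with `(θ₁, θ₂) = (θ + α, θ)`.
[cite: QinWu2025, §1 (1.3)] -/
theorem _root_.Literature.NumberTheory.LFunctions.KMN2021.mollifier_eq (p : ℕ) (θ α c₁ c₂ : ℝ)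
    (χ : DirichletCharacter ℂ p) :
    KMN2021.mollifier p θ α c₁ c₂ χ = mollifier p (θ + α) θ c₁ c₂ χ := rfl

open scoped Classical in
/-- (2.2): `𝓜₁ = (2/φ*(q)) Σ⁺_{χ mod q} L(½,χ) M(χ)` over the even primitive characters
("we provide a detailed analysis of the moments over even primitive characters").
[cite: QinWu2025, §2 (2.2)] -/
def firstMoment (q : ℕ) (θ₁ θ₂ c₁ c₂ : ℝ) : ℂ :=
  (2 / primitiveCount q : ℂ) * ∑ χ : DirichletCharacter ℂ q,
    if χ.IsPrimitive ∧ χ.Even then centralValue q χ * mollifier q θ₁ θ₂ c₁ c₂ χ else 0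

open scoped Classical in
/-- (2.3): `𝓜₂ = (2/φ*(q)) Σ⁺_{χ mod q} |L(½,χ) M(χ)|²` over the even primitive characters.
[cite: QinWu2025, §2 (2.3)] -/
def secondMoment (q : ℕ) (θ₁ θ₂ c₁ c₂ : ℝ) : ℝ :=
  2 / primitiveCount q * ∑ χ : DirichletCharacter ℂ q,
    if χ.IsPrimitive ∧ χ.Even then ‖centralValue q χ * mollifier q θ₁ θ₂ c₁ c₂ χ‖ ^ 2 else 0

/-- `q̊ := ∏_{p^{2k+1} ∥ q, k ≥ 1} p` (1.6): the product of the primes dividing `q` to an ODD power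
at least `3`. [cite: QinWu2025, §1 (1.6)] -/
def oddPart (q : ℕ) : ℕ :=
  ∏ p ∈ q.primeFactors, if 3 ≤ q.factorization p ∧ ¬ 2 ∣ q.factorization p then p else 1

/-- `γ := log q̊ / log q` (Proposition 4: "let `q̊ = q^γ` with `0 ≤ γ ≤ 1/3`").
[cite: QinWu2025, Proposition 4] -/
def gamma (q : ℕ) : ℝ := Real.log (oddPart q) / Real.log q

/-- The range (2.6) of Proposition 4: `4θ₁ + 6θ₂ < 3 + γ`, `2θ₁ + θ₂ < 1 − γ`, `4θ₁ < 1 − γ`.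
[cite: QinWu2025, Proposition 4 (2.6)] -/
def Range (γ θ₁ θ₂ : ℝ) : Prop :=
  4 * θ₁ + 6 * θ₂ < 3 + γ ∧ 2 * θ₁ + θ₂ < 1 - γ ∧ 4 * θ₁ < 1 - γ

/-- The main term of Proposition 4: `c₁²/θ₁ + c₂²/θ₂ + (c₁+c₂)²`. [cite: QinWu2025, Proposition 4 (2.5)] -/
def secondMainTerm (θ₁ θ₂ c₁ c₂ : ℝ) : ℝ := c₁ ^ 2 / θ₁ + c₂ ^ 2 / θ₂ + (c₁ + c₂) ^ 2

/-- The KMN main term is the Qin–Wu main term at `(θ₁, θ₂) = (θ + α, θ)`. [cite: QinWu2025, §2] -/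
theorem _root_.Literature.NumberTheory.LFunctions.KMN2021.secondMainTerm_eq (θ α c₁ c₂ : ℝ) :
    KMN2021.secondMainTerm θ α c₁ c₂ = secondMainTerm (θ + α) θ c₁ c₂ := rfl

/-- Proof of Theorem 1, first display: with `c₁ : c₂ = θ₁ : θ₂` the main terms give the proportion
`(1 + 1/(θ₁+θ₂))⁻¹`. [cite: QinWu2025, §2, proof of Theorem 1] -/
theorem proportion_optimalWeights {θ₁ θ₂ : ℝ} (h₁ : 0 < θ₁) (h₂ : 0 < θ₂) :
    (θ₁ + θ₂) ^ 2 / secondMainTerm θ₁ θ₂ θ₁ θ₂ = (1 + 1 / (θ₁ + θ₂))⁻¹ := by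
  have := KMN2021.proportion_optimalWeights (θ := θ₂) (α := θ₁ - θ₂) h₂ (by linarith)
  rw [KMN2021.proportion, KMN2021.secondMainTerm_eq] at this
  simpa only [add_sub_cancel, show 2 * θ₂ + (θ₁ - θ₂) = θ₁ + θ₂ from by ring, add_comm θ₂ θ₁]
    using this

/-- The printed near-optimal exponents for `0 ≤ γ ≤ 1/5` (proof of Theorem 1):
`θ₁ = (1−γ)/4 − ε`, `θ₂ = (1+γ)/3 − ε` lie in the range (2.6) (this uses `γ ≤ 1/5` exactly in the
second constraint). [cite: QinWu2025, §2, proof of Theorem 1] -/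
theorem range_at_record {γ ε : ℝ} (hε : 0 < ε) (hγ : γ ≤ 1 / 5) :
    Range γ ((1 - γ) / 4 - ε) ((1 + γ) / 3 - ε) := by
  refine ⟨?_, ?_, ?_⟩ <;> linarith

/-- … and give `(1 + 1/(θ₁+θ₂+2ε))⁻¹ = (7+γ)/(19+γ)` at `ε = 0`, which is `≥ 7/19`.
[cite: QinWu2025, §2, proof of Theorem 1] -/
theorem value_at_record {γ : ℝ} (hγ : 0 ≤ γ) :
    (1 + 1 / ((1 - γ) / 4 + (1 + γ) / 3))⁻¹ = (7 + γ) / (19 + γ) := by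
  have h7 : (7 + γ) ≠ 0 := by positivity
  rw [show (1 - γ) / 4 + (1 + γ) / 3 = (7 + γ) / 12 from by ring, one_div_div,
    show (1 : ℝ) + 12 / (7 + γ) = (19 + γ) / (7 + γ) from by field_simp; ring, inv_div]

/-- `7/19 ≤ (7+γ)/(19+γ)` for `γ ≥ 0`. [cite: QinWu2025, §2, proof of Theorem 1] -/
theorem seven_nineteenths_le {γ : ℝ} (hγ : 0 ≤ γ) : (7 : ℝ) / 19 ≤ (7 + γ) / (19 + γ) := by
  rw [div_le_div_iff₀ (by norm_num) (by positivity)]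
  linarith

/-- In the whole range (2.6) the combined length exponent stays below `7/12 + γ/12 (≤ 11/18)`:
`6(θ₁+θ₂) = (4θ₁+6θ₂) + 2θ₁ < (3+γ) + (1−γ)/2`. [cite: QinWu2025, Proposition 4 (2.6)] -/
theorem Range.length_lt {γ θ₁ θ₂ : ℝ} (h : Range γ θ₁ θ₂) : θ₁ + θ₂ < 7 / 12 + γ / 12 := by
  obtain ⟨h₁, -, h₃⟩ := h
  linarith

end QinWu2025

/-- **Qin–Wu 2025, Proposition 3** (mollified first moment, general modulus). For `q ≢ 2 (mod 4)` and
`θ₁, θ₂ ∈ (0, ½ − ε)`: `𝓜₁ = c₁ + c₂ + O(q^{−ε})` ("can be derived from the results in [IS99] and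
[MV00]; a detailed exposition in [KMN22]"). RENDERING: power saving recorded as some `δ > 0`, for all
large `q` (weaker, implied). Status: preprint claim, unrefereed [claim: QinWu2025, status: under-review].
[cite: QinWu2025, Proposition 3] -/
def qinWu2025_proposition3 : Prop :=
  ∀ ε θ₁ θ₂ c₁ c₂ : ℝ, 0 < ε → 0 < θ₁ → θ₁ < 1 / 2 - ε → 0 < θ₂ → θ₂ < 1 / 2 - ε →
    0 < c₁ → 0 < c₂ →
    ∃ δ : ℝ, 0 < δ ∧ ∃ C : ℝ, ∃ q₀ : ℕ, ∀ q : ℕ, q₀ ≤ q → q % 4 ≠ 2 →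
      ‖QinWu2025.firstMoment q θ₁ θ₂ c₁ c₂ - (c₁ + c₂ : ℝ)‖ ≤ C * (q : ℝ) ^ (-δ)

/-- **Qin–Wu 2025, Proposition 4** (mollified second moment, general modulus — the paper's main new
mean-value theorem, via the averaged quartic Kloosterman bound of its Theorem 2). For `q ≢ 2 (mod 4)`,
`q̊ = q^γ` (`0 ≤ γ ≤ 1/3`), and `θ₁, θ₂ ∈ (0, ½ − ε)` with `4θ₁ + 6θ₂ < 3 + γ`, `2θ₁ + θ₂ < 1 − γ`,
`4θ₁ < 1 − γ`: `𝓜₂ = c₁²/θ₁ + c₂²/θ₂ + (c₁+c₂)² + O(log log q / log q)`. RENDERING: `θ₁, θ₂, cᵢ` fixed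
first (pointwise; the paper later lets `θᵢ` depend on `q` through `γ`, a uniformity not recorded here);
the range condition is evaluated at `γ = γ(q)`. Consequence (with Proposition 3, Cauchy–Schwarz and the
PROVED `QinWu2025.proportion_optimalWeights` / `range_at_record` / `value_at_record`): Theorem 1,
`qinWu2025_theorem1` (`7/19`). Status: preprint claim, unrefereed [claim: QinWu2025, status: under-review].
[cite: QinWu2025, Proposition 4] -/
def qinWu2025_proposition4 : Prop :=
  ∀ ε θ₁ θ₂ c₁ c₂ : ℝ, 0 < ε → 0 < θ₁ → θ₁ < 1 / 2 - ε → 0 < θ₂ → θ₂ < 1 / 2 - ε →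
    0 < c₁ → 0 < c₂ →
    ∃ C : ℝ, ∃ q₀ : ℕ, ∀ q : ℕ, q₀ ≤ q → q % 4 ≠ 2 →
      QinWu2025.Range (QinWu2025.gamma q) θ₁ θ₂ →
      |QinWu2025.secondMoment q θ₁ θ₂ c₁ c₂ - QinWu2025.secondMainTerm θ₁ θ₂ c₁ c₂|
        ≤ C * Real.log (Real.log q) / Real.log q


end Literature.NumberTheory.LFunctions
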